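/-
Origin: expansion seat `planner-pub-hodgecm-mc-glue-1-g11-0`, handover #SG1 2026-08-20T16:55:47Z md5 46df360ec088 (REPLACE; pre md5 e3ce1733fa72 → new md5 46df360ec088; 180 l.; (μ4) scope-guard rewrite of the RUN-55 installed file; family glue-1-g9; compiled ok 0 proof-hole) (`HOME/mc/pub-hodgecm-mc-glue-1-g11/stage56/HodgeCM/Model/EndStateMeetOG.lean`, md5 46df360ec088, 180 lines);
landed by the second packager p2 gen 10 (p2-g10) in gate run 56 REPLACES the earlier landed copy of `HodgeCM/Model/EndStateMeetOG.lean` (seat copy carried the packager Origin header of an earlier run (stripped)).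
-/
/-
Origin: glue-1 lane, seat `planner-pub-hodgecm-mc-glue-1-g9-0` (unit pub-hodgecm-mc-glue-1-g9), 2026-08-20 — item (TWIST-2), route (c̄)+(o) OF RECORD
(lead 1-g60 RULING SUPPLEMENT 2, STATUS 2026-08-20 l.12559 (T2)(T4); guard cut model1-g10 G3 l.12580 (B); ownership split axioms-3-g11 l.12578):
the E-side GUARD PATH, bottom.  The PerL end state over an ORIENTED FAMILY of theta models (`EndStateMeetO`, RUN-41 #372) with every input
demanded only at CANONICAL target embeddings `(InfinitePlace.mk ι₁).embedding = ι₁`, concluding `Universe.PerLCanonical` (axioms-3,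
`Model/PerLOfCanonical`, RUN-41 #12) BY NAME.  ADDITIVE LEAF: imports `HodgeCM.Model.Binders.MeetBridges` + `HodgeCM.Model.PerLOfCanonical`;
no existing declaration touched; no new definition, record or cite; every statement kernel-proved from the package as it stands.
-/
import Summits.HodgeConjecture.HodgeCM.Model.Binders.MeetBridges
import Summits.HodgeConjecture.HodgeCM.Model.PerLOfCanonical

/-!
# E4-OG — the PerL END STATE, meeting form, ORIENTED FAMILY, CANONICAL-REPRESENTATIVE GUARD

`Universe.PerL` quantifies over every complex embedding `ι₁` of the normal closure above `φ 0`; the two embeddings of one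
complex place present the SAME Picard modular surface (`Sh(U(V), ι₁) = Sh(U(V^{c_L}), ῑ₁)`, axioms-3's c_L-twist
re-presentation `Model.perL_of_perLCanonical`), so it is enough to serve the canonical representative
`(InfinitePlace.mk ι₁).embedding = ι₁` of each place: `Universe.PerLCanonical`.  This file is the E side of that cut: the
pointwise end state of `EndStateMeetO` with the guard available to — and demanded by — every one of the six inputs, placed
right after the class hypothesis `S c` (model1's G3.2: the class-predicate folding `S c ∧ guard`, curried).

Contents: `ModelAxiomsPerL.perLCanonical_of_ptOG` (family + guard form of `realisationExistsPerL₂_of_pt`, composed per target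
with `perL44_holds₂` / `perL_of_perL44`), and the headlines `Assembly.perLCanonical_ofSignRecipeOG₁₀`,
`Assembly.perLCanonical_ofFunBridgesOG₁₀` for the family `fun L ι₁ => C.thetaModel (hb L ι₁) d12 d34`.
-/

noncomputable section

open scoped InnerProductSpace

namespace HodgeCM

open HodgeCM.Prior.Perl34File

namespace Universe

variable {U : Universe}

namespace ModelAxiomsPerL

/-- **The CANONICALLY GUARDED `W_per^L` (`Universe.PerLCanonical`) from the pointwise meeting inputs of a FAMILY of theta
models** `T L ι₁`, each member read only at its own universe `(L, ι₁)`, each input demanded only at targets whose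
embedding is the CANONICAL representative of its complex place, `(InfinitePlace.mk ι₁).embedding = ι₁` (the guard follows
the class hypothesis `S c`): the proofs of `realisationExistsPerL₂_of_pt`, `perL44_holds₂` and `Assembly.perL_of_perL44`
run per target after `ι₁` and the guard are introduced (Landherr's `V` from `StubTree.landherr_exists`). -/
theorem perLCanonical_of_ptOG (M : U.ModelAxiomsPerL) (T : ∀ (L : CMField), (L →+* ℂ) → U.ThetaModel)
    (hHR : U.Fact_hodgeRiemann20)
    (hκ : ∀ (L : CMField) (ι₁ : L →+* ℂ), (T L ι₁).Design_kappaConj)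
    (hs : ∀ (L : CMField) (ι₁ : L →+* ℂ), (T L ι₁).Design_frameSignConj)
    {S : ∀ {L : CMField}, SeesawCtx L → Prop}
    (hS : ∀ {L : CMField} (c : SeesawCtx L), Module.finrank ℚ c.K = 6 → IsNormalClosure ℚ c.K L →
      (Module.finrank ℚ L = 24 ∨ Module.finrank ℚ L = 48) → S c)
    (innerEmb : ∀ {L : CMField} {ι₁ : L →+* ℂ} (V : HermSpace3 L ι₁) (c : SeesawCtx L),
      (T L ι₁).GoodCtx ι₁ c → S c → (NumberField.InfinitePlace.mk ι₁).embedding = ι₁ → (T L ι₁).InnerEmbAt V)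
    (thetaSub : ∀ {L : CMField} {ι₁ : L →+* ℂ} (V : HermSpace3 L ι₁) (c : SeesawCtx L),
      (T L ι₁).GoodCtx ι₁ c → S c → (NumberField.InfinitePlace.mk ι₁).embedding = ι₁ →
      ∀ (i : Fin 4) (Γ : Level V), (T L ι₁).Theta V c i Γ ⊆ U.Uiso Γ c.K (c.Ψ i) c.σ)
    (thetaWedge : ∀ {L : CMField} {ι₁ : L →+* ℂ} (V : HermSpace3 L ι₁) (c : SeesawCtx L),
      (T L ι₁).GoodCtx ι₁ c → S c → (NumberField.InfinitePlace.mk ι₁).embedding = ι₁ →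
      ∃ Γ : Level V, ∃ ω₁ ∈ (T L ι₁).Theta V c 0 Γ, ∃ ω₂ ∈ (T L ι₁).Theta V c 1 Γ,
        U.cup2C (U.pms L ι₁ V Γ) 1 ω₁ ω₂ ≠ 0)
    (gen12Meet : ∀ {L : CMField} {ι₁ : L →+* ℂ} (V : HermSpace3 L ι₁) (c : SeesawCtx L),
      (T L ι₁).GoodCtx ι₁ c → S c → (NumberField.InfinitePlace.mk ι₁).embedding = ι₁ → (T L ι₁).Gen12MeetAt V c)
    (real34Meet : ∀ {L : CMField} {ι₁ : L →+* ℂ} (V : HermSpace3 L ι₁) (c : SeesawCtx L),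
      (T L ι₁).GoodCtx ι₁ c → S c → (NumberField.InfinitePlace.mk ι₁).embedding = ι₁ → (T L ι₁).Real34MeetAt V c)
    (occ : ∀ {L : CMField} {ι₁ : L →+* ℂ} (V : HermSpace3 L ι₁) (c : SeesawCtx L),
      (T L ι₁).GoodCtx ι₁ c → S c → (NumberField.InfinitePlace.mk ι₁).embedding = ι₁ →
      (∀ (Φ : (T L ι₁).SK V c) (i : (T L ι₁).SigIdx V c),
          (∃ v ∈ ((T L ι₁).core V c).hatσ i, ((T L ι₁).core V c).TΦ Φ v ≠ 0) → ((T L ι₁).t12 V c).wOccurs i) ∧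
        (∀ (Φ : (T L ι₁).SK V c) (i : (T L ι₁).SigIdx V c),
          (∃ v ∈ ((T L ι₁).core V c).hatσ i, ((T L ι₁).core V c).TΦ Φ v ≠ 0) → ((T L ι₁).t34 V c).wOccurs i)) :
    U.PerLCanonical := by
  intro K L j hN hK h24 φ hφ ι₁ hι₁ hcan t ht
  obtain ⟨V⟩ := StubTree.landherr_exists L ι₁
  refine ⟨V, ?_⟩
  have hmem : ∀ i, φ 0 ∈ (t i).1 := fun i => (ht i 0).mpr (by fin_cases i <;> rfl)
  have hΨ : PairSum t := StubTree.pairSum_of_isPerLTypes K φ hφ hK t ht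
  obtain ⟨D, hD⟩ := (T L ι₁).exists_seesawDatum_constructed (hκ L ι₁) (hs L ι₁) j ι₁ t hΨ
  let c : SeesawCtx L := ⟨K, t, φ 0, D⟩
  have hc : (T L ι₁).GoodCtx ι₁ c := ⟨hΨ, StubTree.injective_of_isPerLTypes K φ hφ t ht, hmem, ⟨j, hι₁, hD⟩⟩
  have hSc : S c := hS c hK hN h24
  obtain ⟨R⟩ := nonempty_thetaRealisation₂_at_allChars M (T L ι₁) hHR V c (innerEmb V c hc hSc hcan)
    (thetaSub V c hc hSc hcan) (thetaWedge V c hc hSc hcan) (gen12Meet V c hc hSc hcan) (real34Meet V c hc hSc hcan)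
    (occ V c hc hSc hcan)
  exact thm44_of_realisation₂ M R

end ModelAxiomsPerL

end Universe

/-! ## Guarded headlines for the oriented family `fun L ι₁ => C.thetaModel (hb L ι₁) d12 d34` -/

namespace Assembly

open HodgeCM.Universe (AdelicThetaCore₀ SideData ThetaModel ModelAxiomsPerL)

variable (U : Universe)

/-- **E4-OG, POINTWISE, PER-PLACE RECIPE BIT, CANONICAL-REPRESENTATIVE GUARD**: `perL_ofSignRecipeO₁₀` with every input
additionally guarded by `(InfinitePlace.mk ι₁).embedding = ι₁` after its class hypothesis; conclusion `U.PerLCanonical`. -/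
theorem perLCanonical_ofSignRecipeOG₁₀ (M : U.ModelAxiomsPerL) (hb : ∀ L : CMField, (L →+* ℂ) → Bool) (C : U.AdelicThetaCore₀)
    (d12 d34 : ∀ {L : CMField}, SeesawCtx L → SideData L) {S : ∀ {L : CMField}, SeesawCtx L → Prop}
    (hS : ∀ {L : CMField} (c : SeesawCtx L), Module.finrank ℚ c.K = 6 → IsNormalClosure ℚ c.K L →
      (Module.finrank ℚ L = 24 ∨ Module.finrank ℚ L = 48) → S c)
    (innerEmb : ∀ {L : CMField} {ι₁ : L →+* ℂ} (V : HermSpace3 L ι₁) (c : SeesawCtx L),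
      (C.thetaModel (hb L ι₁) d12 d34).GoodCtx ι₁ c → S c → (NumberField.InfinitePlace.mk ι₁).embedding = ι₁ → (C.thetaModel (hb L ι₁) d12 d34).InnerEmbAt V)
    (thetaSub : ∀ {L : CMField} {ι₁ : L →+* ℂ} (V : HermSpace3 L ι₁) (c : SeesawCtx L),
      (C.thetaModel (hb L ι₁) d12 d34).GoodCtx ι₁ c → S c → (NumberField.InfinitePlace.mk ι₁).embedding = ι₁ →
      ∀ (i : Fin 4) (Γ : Level V), (C.thetaModel (hb L ι₁) d12 d34).Theta V c i Γ ⊆ U.Uiso Γ c.K (c.Ψ i) c.σ)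
    (thetaWedge : ∀ {L : CMField} {ι₁ : L →+* ℂ} (V : HermSpace3 L ι₁) (c : SeesawCtx L),
      (C.thetaModel (hb L ι₁) d12 d34).GoodCtx ι₁ c → S c → (NumberField.InfinitePlace.mk ι₁).embedding = ι₁ →
      ∃ Γ : Level V, ∃ ω₁ ∈ (C.thetaModel (hb L ι₁) d12 d34).Theta V c 0 Γ,
        ∃ ω₂ ∈ (C.thetaModel (hb L ι₁) d12 d34).Theta V c 1 Γ, U.cup2C (U.pms L ι₁ V Γ) 1 ω₁ ω₂ ≠ 0)
    (gen12Meet : ∀ {L : CMField} {ι₁ : L →+* ℂ} (V : HermSpace3 L ι₁) (c : SeesawCtx L),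
      (C.thetaModel (hb L ι₁) d12 d34).GoodCtx ι₁ c → S c → (NumberField.InfinitePlace.mk ι₁).embedding = ι₁ → (C.thetaModel (hb L ι₁) d12 d34).Gen12MeetAt V c)
    (real34Meet : ∀ {L : CMField} {ι₁ : L →+* ℂ} (V : HermSpace3 L ι₁) (c : SeesawCtx L),
      (C.thetaModel (hb L ι₁) d12 d34).GoodCtx ι₁ c → S c → (NumberField.InfinitePlace.mk ι₁).embedding = ι₁ → (C.thetaModel (hb L ι₁) d12 d34).Real34MeetAt V c)
    (occ : ∀ {L : CMField} {ι₁ : L →+* ℂ} (V : HermSpace3 L ι₁) (c : SeesawCtx L),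
      (C.thetaModel (hb L ι₁) d12 d34).GoodCtx ι₁ c → S c → (NumberField.InfinitePlace.mk ι₁).embedding = ι₁ →
      (∀ (Φ : (C.thetaModel (hb L ι₁) d12 d34).SK V c) (i : (C.thetaModel (hb L ι₁) d12 d34).SigIdx V c),
          (∃ v ∈ ((C.thetaModel (hb L ι₁) d12 d34).core V c).hatσ i,
            ((C.thetaModel (hb L ι₁) d12 d34).core V c).TΦ Φ v ≠ 0) →
          ((C.thetaModel (hb L ι₁) d12 d34).t12 V c).wOccurs i) ∧
        (∀ (Φ : (C.thetaModel (hb L ι₁) d12 d34).SK V c) (i : (C.thetaModel (hb L ι₁) d12 d34).SigIdx V c),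
          (∃ v ∈ ((C.thetaModel (hb L ι₁) d12 d34).core V c).hatσ i,
            ((C.thetaModel (hb L ι₁) d12 d34).core V c).TΦ Φ v ≠ 0) →
          ((C.thetaModel (hb L ι₁) d12 d34).t34 V c).wOccurs i))
    (hHR : U.Fact_hodgeRiemann20) : U.PerLCanonical :=
  M.perLCanonical_of_ptOG (fun L ι₁ => C.thetaModel (hb L ι₁) d12 d34) hHR
    (fun L ι₁ => C.design_kappaConj (hb L ι₁) d12 d34) (fun L ι₁ => C.design_frameSignConj (hb L ι₁) d12 d34) hS
    innerEmb thetaSub thetaWedge gen12Meet real34Meet occ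

/-- **₁₀-OG over the FUNCTION-LEVEL bridges**, per-place recipe bit, canonical-representative guard on every input;
conclusion `U.PerLCanonical`. -/
theorem perLCanonical_ofFunBridgesOG₁₀ (M : U.ModelAxiomsPerL) (hb : ∀ L : CMField, (L →+* ℂ) → Bool) (C : U.AdelicThetaCore₀)
    (d12 d34 : ∀ {L : CMField}, SeesawCtx L → SideData L) {S : ∀ {L : CMField}, SeesawCtx L → Prop}
    (hS : ∀ {L : CMField} (c : SeesawCtx L), Module.finrank ℚ c.K = 6 → IsNormalClosure ℚ c.K L →
      (Module.finrank ℚ L = 24 ∨ Module.finrank ℚ L = 48) → S c)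
    (innerEmb : ∀ {L : CMField} {ι₁ : L →+* ℂ} (V : HermSpace3 L ι₁) (c : SeesawCtx L),
      (C.thetaModel (hb L ι₁) d12 d34).GoodCtx ι₁ c → S c → (NumberField.InfinitePlace.mk ι₁).embedding = ι₁ → (C.thetaModel (hb L ι₁) d12 d34).InnerEmbAt V)
    (thetaSub : ∀ {L : CMField} {ι₁ : L →+* ℂ} (V : HermSpace3 L ι₁) (c : SeesawCtx L),
      (C.thetaModel (hb L ι₁) d12 d34).GoodCtx ι₁ c → S c → (NumberField.InfinitePlace.mk ι₁).embedding = ι₁ →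
      ∀ (i : Fin 4) (Γ : Level V), (C.thetaModel (hb L ι₁) d12 d34).Theta V c i Γ ⊆ U.Uiso Γ c.K (c.Ψ i) c.σ)
    (thetaWedge : ∀ {L : CMField} {ι₁ : L →+* ℂ} (V : HermSpace3 L ι₁) (c : SeesawCtx L),
      (C.thetaModel (hb L ι₁) d12 d34).GoodCtx ι₁ c → S c → (NumberField.InfinitePlace.mk ι₁).embedding = ι₁ →
      ∃ Γ : Level V, ∃ ω₁ ∈ (C.thetaModel (hb L ι₁) d12 d34).Theta V c 0 Γ,
        ∃ ω₂ ∈ (C.thetaModel (hb L ι₁) d12 d34).Theta V c 1 Γ, U.cup2C (U.pms L ι₁ V Γ) 1 ω₁ ω₂ ≠ 0)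
    (gen12 : ∀ {L : CMField} {ι₁ : L →+* ℂ} (V : HermSpace3 L ι₁) (c : SeesawCtx L),
      (C.thetaModel (hb L ι₁) d12 d34).GoodCtx ι₁ c → S c → (NumberField.InfinitePlace.mk ι₁).embedding = ι₁ →
      Nonempty ((C.thetaModel (hb L ι₁) d12 d34).Gen12FunBridge V c))
    (real34 : ∀ {L : CMField} {ι₁ : L →+* ℂ} (V : HermSpace3 L ι₁) (c : SeesawCtx L),
      (C.thetaModel (hb L ι₁) d12 d34).GoodCtx ι₁ c → S c → (NumberField.InfinitePlace.mk ι₁).embedding = ι₁ →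
      Nonempty ((C.thetaModel (hb L ι₁) d12 d34).Real34FunBridge V c))
    (occ : ∀ {L : CMField} {ι₁ : L →+* ℂ} (V : HermSpace3 L ι₁) (c : SeesawCtx L),
      (C.thetaModel (hb L ι₁) d12 d34).GoodCtx ι₁ c → S c → (NumberField.InfinitePlace.mk ι₁).embedding = ι₁ →
      (∀ (Φ : (C.thetaModel (hb L ι₁) d12 d34).SK V c) (i : (C.thetaModel (hb L ι₁) d12 d34).SigIdx V c),
          (∃ v ∈ ((C.thetaModel (hb L ι₁) d12 d34).core V c).hatσ i,
            ((C.thetaModel (hb L ι₁) d12 d34).core V c).TΦ Φ v ≠ 0) →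
          ((C.thetaModel (hb L ι₁) d12 d34).t12 V c).wOccurs i) ∧
        (∀ (Φ : (C.thetaModel (hb L ι₁) d12 d34).SK V c) (i : (C.thetaModel (hb L ι₁) d12 d34).SigIdx V c),
          (∃ v ∈ ((C.thetaModel (hb L ι₁) d12 d34).core V c).hatσ i,
            ((C.thetaModel (hb L ι₁) d12 d34).core V c).TΦ Φ v ≠ 0) →
          ((C.thetaModel (hb L ι₁) d12 d34).t34 V c).wOccurs i))
    (hHR : U.Fact_hodgeRiemann20) : U.PerLCanonical :=
  perLCanonical_ofSignRecipeOG₁₀ U M hb C d12 d34 hS innerEmb thetaSub thetaWedge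
    (fun {L} {ι₁} V c hc hSc hcan =>
      (C.thetaModel (hb L ι₁) d12 d34).gen12MeetAt_of_nonempty_funBridge (gen12 V c hc hSc hcan))
    (fun {L} {ι₁} V c hc hSc hcan =>
      (C.thetaModel (hb L ι₁) d12 d34).real34MeetAt_of_nonempty_funBridge (real34 V c hc hSc hcan))
    occ hHR

end Assembly

end HodgeCM

end
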